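import Literature.Barriers.RiemannHypothesis.NymanBeurlingObstructionsBDBLSProofs
import Summits.RiemannHypothesis.RiemannHypothesis.Theorems.NymanBeurlingMinimiserCriterion
import HarnessLib

/-!
# RiemannHypothesis / Nyman–Beurling — the certified column `d_N² · log N` has a kernel-proved POSITIVE FLOOR (RH-FREE):
the BDBLS lower bound read on the DATA object

Column LI/NB of the RH ladder, rung L-P(P2) «structure of the NB minimiser», PROOF-OF-DATA for cell `pub/rh-li`.
DATUM (DATA.md §L, lineage R, certified at every `N ≤ 10⁴`): `d_N² log N ∈ [0.0451, 0.0458]` on `[5·10³, 10⁴]`.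
THEOREM (this file, from the tree's PROVED uniform Báez-Duarte–Balazard–Landreau–Saias bound
`Literature.Barriers.RiemannHypothesis.BDBLS2000_uniform_holds` — one Hardy zero on the line, Báez-Duarte's unitary `U`):

* `exists_pos_le_nbDistSq_mul_log`: there is an absolute `C > 0` with `C ≤ d_N²(c) · log N` for every `N ≥ 2` and EVERY
  coefficient vector `c` (dictionary: `natError N c = ‖χ − f_c‖_{L²(0,∞)} = √(nbDistSq N c)`, `Criterion.eLpNorm_approx_eq`);
* `exists_pos_le_nbDistSq_nbMinimiser_mul_log`: in particular for the DATA object `c⋆_N` — the tabulated column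
  `d2*logN` can never drop below `C`, unconditionally.

The constant is inexplicit (it comes from an unspecified zero `½ + iγ`); the printed asymptotic constant is
`Σ_ρ m_ρ²/|ρ|²` (Burnol 2002), `= 2 + γ − log 4π = 0.0462…` under RH with simple zeros — the BDBLS conjecture
`d_N² ~ (2+γ−log 4π)/log N` is NOT claimed.  RH-FREE [rh-li-eng-3]; nothing here bears on the truth of RH.
-/

noncomputable section

-- D-0017: `Summit.<S>.<S>.…` is the designed namespace of a single-problem summit.
set_option linter.dupNamespace false

open MeasureTheory Set Finset

namespace Summit.RiemannHypothesis.RiemannHypothesis.Theorems.NbTheory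

open Literature.NumberTheory.LFunctions Literature.NumberTheory.LFunctions.BaezDuarteOnlyIf
open Literature.Barriers.RiemannHypothesis

/-- **A positive floor for `d_N²(c)·log N` (RH-FREE; BDBLS 2000, kernel-proved in the tree):** there is `C > 0` such that
`C ≤ d_N²(c) · log N` for all `N ≥ 2` and all real coefficient vectors `c`. -/
theorem exists_pos_le_nbDistSq_mul_log :
    ∃ C : ℝ, 0 < C ∧ ∀ (N : ℕ) (c : Fin N → ℝ), 2 ≤ N → C ≤ nbDistSq N c * Real.log N := by
  obtain ⟨C, hC, h⟩ := natError_ge_of_uniform BDBLS2000_uniform_holds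
  refine ⟨C ^ 2, by positivity, fun N c hN ↦ ?_⟩
  have h1 := h N c hN
  rw [natError_eq] at h1
  have h2 : ENNReal.ofReal (C / Real.sqrt (Real.log N)) ≤ ENNReal.ofReal (Real.sqrt (nbDistSq N c)) := by
    rw [← Criterion.eLpNorm_approx_eq]
    exact h1
  rw [ENNReal.ofReal_le_ofReal_iff (Real.sqrt_nonneg _)] at h2
  have hL : 0 < Real.log N := Real.log_pos (by exact_mod_cast hN)
  have hsL : 0 < Real.sqrt (Real.log N) := Real.sqrt_pos.2 hL
  have hd : 0 ≤ nbDistSq N c := (nbDistSq_pos c).le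
  have h3 : C ≤ Real.sqrt (nbDistSq N c) * Real.sqrt (Real.log N) := by rwa [div_le_iff₀ hsL] at h2
  have h4 : C ^ 2 ≤ (Real.sqrt (nbDistSq N c) * Real.sqrt (Real.log N)) ^ 2 := pow_le_pow_left₀ hC.le h3 2
  calc C ^ 2 ≤ (Real.sqrt (nbDistSq N c) * Real.sqrt (Real.log N)) ^ 2 := h4
    _ = nbDistSq N c * Real.log N := by rw [mul_pow, Real.sq_sqrt hd, Real.sq_sqrt hL.le]

/-- **The DATA column `d2*logN` has a positive kernel-proved floor (RH-FREE):** `∃ C > 0, ∀ N ≥ 2, C ≤ d_N² · log N` for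
the Báez-Duarte minimiser `c⋆_N = G⁻¹ b` tabulated in DATA.md §L. -/
theorem exists_pos_le_nbDistSq_nbMinimiser_mul_log :
    ∃ C : ℝ, 0 < C ∧ ∀ N : ℕ, 2 ≤ N → C ≤ nbDistSq N (nbMinimiser N) * Real.log N := by
  obtain ⟨C, hC, h⟩ := exists_pos_le_nbDistSq_mul_log
  exact ⟨C, hC, fun N hN ↦ h N (nbMinimiser N) hN⟩

end Summit.RiemannHypothesis.RiemannHypothesis.Theorems.NbTheory

end
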